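import Summits.SmoothPoincare4.SmoothPoincare4.Theses.VerlindeRLinks
import Summits.SmoothPoincare4.SmoothPoincare4.Theorems.VrlSlideGap.Negative.SmallComponentCounts
import Summits.SmoothPoincare4.SmoothPoincare4.Theorems.VrlSliceRigidity.Negative.LoadBearing
import Literature.Topology.FourManifolds.LinkingNumberPushOffInstance
import Literature.Topology.FourManifolds.KirbyCalculusUnlinkProofs
import Literature.Topology.FourManifolds.KirbyMovesProofs
import Literature.Topology.FourManifolds.KirbyCalculusStrict
import Literature.Topology.FourManifolds.LinkSurgeryExistence
import HarnessLib.Audit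

/-!
# Negative lemmas for crux `VerlindeRLinks.VrlSlideGap` (stmt-SmoothPoincare4-16178):
# load-bearing conjuncts, `n ≥ 2`, refuted strengthenings, certificate shape

Disprover seat `refuter-cdisprove-stmt-SmoothPoincare4-16178-0`, cycle 1 (2026-08-17); the
annotated work file is `Cruxes/VrlSlideGap/Disproof.lean`. The crux is, kernel-checked, the
negation of the PRINTED Generalised Property R conjecture
(`Literature.Topology.FourManifolds.StrictGeneralizedPropertyRConjecture`), open and believed to
point the crux's way (GST 2010 §1); no refutation exists cheaply. This file lands what the
negative side CAN certify about the crux's own conjuncts and conclusion, reusing the landed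
`n = 0 / n = 1` lemmas of `VrlSlideGap/Negative/SmallComponentCounts.lean` and the `(unknot, 1)`
witness lemmas of the sibling file `VrlSliceRigidity/Negative/LoadBearing.lean`:

* `invariant_of_equiv` — the invariant principle for `IsStrictHandleSlideEquivalent`
  (move-invariance ⇒ class-invariance: the whole "functoriality ⇒ invariance" glue of any
  certificate line);
* LOAD-BEARING ANALYSIS of the `∃`-crux (dual form: delete ONE conjunct and the statement becomes
  TRIVIALLY TRUE by a witness unrelated to Property R — so every proof must use that conjunct),
  all four OUTRIGHT: `trivial_without_rlink` (both surgery conjuncts deleted),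
  `trivial_without_surgeryLink` (`L.IsSurgery Y` deleted), `trivial_without_sphereSum`
  (`Y ≅ #ⁿ S²×S¹` deleted), `trivial_without_noSlideClause` (no-slide clause deleted: R-links
  exist, the data conjuncts are inhabited, the crux is not vacuous);
* `two_le_of_witness` — every witness has `n ≥ 2`, modulo Property R stated in the crux's own
  vocabulary as the explicit hypothesis `hR` (Gabai 1987 Cor. 8.3 + `H₁`, in print);
* STRENGTHENINGS REFUTED: `not_forall_rlink_gap` ("every R-link with `n ≥ 1` resists" is false
  on the `0`-framed unknot); `gap_false_with_kirbyMoves_of` (admit blow-ups, i.e. replace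
  `IsStrictHandleSlideEquivalent` by `StrictKirbyEquivalent`: FALSE modulo Kirby's theorem, the
  uniqueness of `#ⁿ S²×S¹` and two elementary unlink facts, all explicit hypotheses — the
  exclusion of blow-ups is the load-bearing feature of the conclusion's relation);
* CERTIFICATE SHAPE: `exists_separating_invariant_of_vrlSlideGap` — the crux already yields a
  strict-slide invariant (valued in `Prop`) separating its witness from every `0`-framed unlink;
  with `invariant_of_equiv` this shows that a skeleton "move-functorial invariant ∧ certificate
  ⇒ crux" with an UNNAMED invariant restates the crux (content enters only with a named,
  computable invariant — recorded for the picked line `Sketch` = slide-coinvariants).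

No definition, no named fact, no `sorry`; print facts enter as explicit hypotheses.
References: [GompfScharlemannThompson2010, §2 Conj. 1, Prop. 2.2, §3]; [GabaiJDG1987, Cor. 8.3];
[Kirby1978, Thm 1]; [GompfStipsicz1999, §5.3, Thm 5.3.6].
-/

noncomputable section

-- every `Summit.SmoothPoincare4.SmoothPoincare4.…` name repeats the summit = sub-problem segment
-- (D-0017 layout); the duplicate is deliberate.
set_option linter.dupNamespace false

namespace Summit.SmoothPoincare4.SmoothPoincare4.Theorems.VrlSlideGap.Negative.LoadBearing

open scoped Manifold ContDiff Topology
open Function Set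
open Literature.Topology.FourManifolds
open Summit.SmoothPoincare4.SmoothPoincare4.Theses.VerlindeRLinks (VrlSlideGap)
open Summit.SmoothPoincare4.SmoothPoincare4.Theorems.VrlSlideGap.Negative
  (no_gap_at_zero not_equiv_zeroFramedUnlink_of_framing_ne_zero)
open Summit.SmoothPoincare4.SmoothPoincare4.Theorems.VrlSliceRigidity.Negative
  (single_unknot_zero_isZeroFramedUnlink not_equiv_single_unknot_one_zeroFramed
    connectedSpace_of_isSurgery_single_unknot_one)

/-! ## The invariant principle -/

/-- **Invariant principle.** A function of framed links that is constant along every strict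
handle-slide MOVE is constant on strict handle-slide CLASSES (`Relation.EqvGen` induction).
[folklore] -/
theorem invariant_of_equiv {M : Sort*} (σ : FramedLinkFin → M)
    (hσ : ∀ L L' : FramedLinkFin, StrictHandleSlideMove L L' → σ L = σ L')
    {L L' : FramedLinkFin} (h : IsStrictHandleSlideEquivalent L L') : σ L = σ L' := by
  unfold IsStrictHandleSlideEquivalent at h
  induction h with
  | rel _ _ h => exact hσ _ _ h
  | refl => rfl
  | symm _ _ _ ih => exact ih.symm
  | trans _ _ _ _ _ ih₁ ih₂ => exact ih₁.trans ih₂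

/-- The `0`-framed unknot is an R-link with `n = 1`: its surgery exists as a closed connected
smooth 3-manifold `Y ≅ S³ # (S² × S¹)` (tree theorem `exists_isSurgery_zeroFramedUnlink_holds`).
[cite: GompfStipsicz1999, §5.3] -/
theorem exists_rlink_one :
    ∃ (Y : Type) (_ : TopologicalSpace Y) (_ : T2Space Y) (_ : SecondCountableTopology Y)
      (_ : ChartedSpace (EuclideanSpace ℝ (Fin 3)) Y) (_ : IsManifold (𝓡 3) ∞ Y)
      (_ : CompactSpace Y) (_ : ConnectedSpace Y),
      IsSphereTwoProdCircleSum 1 Y ∧ (FramedLink.single unknot 0).IsSurgery (𝓡 3) Y :=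
  exists_isSurgery_zeroFramedUnlink_holds _ single_unknot_zero_isZeroFramedUnlink

/-! ## Load-bearing analysis: delete one conjunct, get a trivially true statement -/

/-- **Without the R-link hypothesis the crux is trivially true**: delete BOTH surgery conjuncts
(and the then idle manifold binders); the `(+1)`-framed unknot is a witness, by framing rigidity
at `n = 1` alone (`not_equiv_single_unknot_one_zeroFramed`). Every proof of the crux must use
the surgery conjuncts. [folklore] -/
theorem trivial_without_rlink :
    ∃ (_ : Knot.TubularNbhd.SmoothnessFacts) (n : ℕ) (L : FramedLink (Fin n)),
      ∀ U : FramedLink (Fin n), U.IsZeroFramedUnlink →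
        ¬ IsStrictHandleSlideEquivalent ⟨n, L⟩ ⟨n, U⟩ :=
  ⟨inferInstance, 1, FramedLink.single unknot 1,
    fun _ hU ↦ not_equiv_single_unknot_one_zeroFramed hU⟩

/-- **Without the conjunct `L.IsSurgery (𝓡 3) Y` the crux is trivially true** (all binders
kept): `L = (unknot, 1)` and `Y ≅ S³ # (S² × S¹)` borrowed from the `0`-framed unknot. So the
conjunct tying `L` to `Y` is load-bearing, not merely the existence of some `#ⁿ (S² × S¹)`.
[folklore] -/
theorem trivial_without_surgeryLink :
    ∃ (_ : Knot.TubularNbhd.SmoothnessFacts) (n : ℕ) (L : FramedLink (Fin n)) (Y : Type)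
      (_ : TopologicalSpace Y) (_ : T2Space Y) (_ : SecondCountableTopology Y)
      (_ : ChartedSpace (EuclideanSpace ℝ (Fin 3)) Y) (_ : IsManifold (𝓡 3) ∞ Y)
      (_ : CompactSpace Y) (_ : ConnectedSpace Y),
      IsSphereTwoProdCircleSum n Y ∧
        ∀ U : FramedLink (Fin n), U.IsZeroFramedUnlink →
          ¬ IsStrictHandleSlideEquivalent ⟨n, L⟩ ⟨n, U⟩ := by
  obtain ⟨Y, i1, i2, i3, i4, i5, i6, i7, hY, -⟩ := exists_rlink_one
  exact ⟨inferInstance, 1, FramedLink.single unknot 1, Y, i1, i2, i3, i4, i5, i6, i7, hY,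
    fun _ hU ↦ not_equiv_single_unknot_one_zeroFramed hU⟩

/-- **Without the conjunct `IsSphereTwoProdCircleSum n Y` the crux is trivially true** (all
binders kept): `L = (unknot, 1)` with its closed connected surgery `Y` (existence
`FramedLink.exists_isSurgery_holds`, connectedness `connectedSpace_of_isSurgery_single_unknot_one`,
both proved in the tree; on paper `Y = S³`). So it is the identification of the surgery AS
`#ⁿ (S² × S¹)` that is load-bearing, not the existence of a surgery. [folklore] -/
theorem trivial_without_sphereSum :
    ∃ (_ : Knot.TubularNbhd.SmoothnessFacts) (n : ℕ) (L : FramedLink (Fin n)) (Y : Type)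
      (_ : TopologicalSpace Y) (_ : T2Space Y) (_ : SecondCountableTopology Y)
      (_ : ChartedSpace (EuclideanSpace ℝ (Fin 3)) Y) (_ : IsManifold (𝓡 3) ∞ Y)
      (_ : CompactSpace Y) (_ : ConnectedSpace Y),
      L.IsSurgery (𝓡 3) Y ∧
        ∀ U : FramedLink (Fin n), U.IsZeroFramedUnlink →
          ¬ IsStrictHandleSlideEquivalent ⟨n, L⟩ ⟨n, U⟩ := by
  obtain ⟨Y, i1, i2, i3, i4, i5, i6, hL⟩ :=
    FramedLink.exists_isSurgery_holds (FramedLink.single unknot 1)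
  haveI : ConnectedSpace Y := connectedSpace_of_isSurgery_single_unknot_one hL
  exact ⟨inferInstance, 1, FramedLink.single unknot 1, Y, i1, i2, i3, i4, i5, i6, ‹_›, hL,
    fun _ hU ↦ not_equiv_single_unknot_one_zeroFramed hU⟩

/-- **Without the no-slide clause the crux is trivially true**: R-links exist, e.g. the
`0`-framed unknot (`exists_rlink_one`). Hence the data conjuncts of the crux are INHABITED (the
crux is not vacuous) and the no-slide clause is load-bearing. [folklore] -/
theorem trivial_without_noSlideClause :
    ∃ (_ : Knot.TubularNbhd.SmoothnessFacts) (n : ℕ) (L : FramedLink (Fin n)) (Y : Type)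
      (_ : TopologicalSpace Y) (_ : T2Space Y) (_ : SecondCountableTopology Y)
      (_ : ChartedSpace (EuclideanSpace ℝ (Fin 3)) Y) (_ : IsManifold (𝓡 3) ∞ Y)
      (_ : CompactSpace Y) (_ : ConnectedSpace Y),
      IsSphereTwoProdCircleSum n Y ∧ L.IsSurgery (𝓡 3) Y := by
  obtain ⟨Y, i1, i2, i3, i4, i5, i6, i7, hY, hL⟩ := exists_rlink_one
  exact ⟨inferInstance, 1, FramedLink.single unknot 0, Y, i1, i2, i3, i4, i5, i6, i7, hY, hL⟩

/-! ## Witnesses have at least two components, modulo Property R -/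

/-- A framed knot whose knot is the unknot (`F 1 ∘ K = unknot` for an ambient isotopy `F`) and
whose framing is `0` is strictly slide-equivalent to the `0`-framed unknot, by ONE isotopy move.
[folklore] -/
theorem equiv_single_unknot_of_isUnknot (L : FramedLink (Fin 1))
    (hK : (L.component 0).IsUnknot) (hf : L.framing 0 = 0) :
    IsStrictHandleSlideEquivalent ⟨1, L⟩ ⟨1, FramedLink.single unknot 0⟩ := by
  obtain ⟨F, hF⟩ := hK
  refine Relation.EqvGen.rel _ _ (StrictHandleSlideMove.isotopy ⟨⟨F, fun i ↦ ?_⟩, ?_⟩)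
  · rw [Subsingleton.elim i 0]
    exact hF
  · funext i
    rw [Subsingleton.elim i 0, hf]
    rfl

/-- **Every witness of the crux has `n ≥ 2`, modulo Property R.** The hypothesis `hR` is the
`n = 1` slice of printed GPRC in conclusion form, true in print: if integral surgery on a framed
knot `(K, m)` is `S³ # (S² × S¹)` then `m = 0` (`H₁`, GST 2010 Prop. 2.2) and `K` is the unknot
(Gabai, J. Differential Geom. 26 (1987) Cor. 8.3; tree named fact
`isUnknot_of_isIntegralSurgery_zero` over the model `S² × S¹`, plus uniqueness of surgery and of
connected sums to pass from `IsSphereTwoProdCircleSum 1 Y`). Given `hR`, an `n = 1` R-link is the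
`0`-framed unknot up to one isotopy move, which IS a `0`-framed unlink
(`single_unknot_zero_isZeroFramedUnlink`); `n = 0` is `no_gap_at_zero`. Witness searches start at
`n = 2` (GST 2010 §3: at `n = 2` no component is the unknot, Prop. 3.2, and the tunnel number is
not `1`, Prop. 3.1). [cite: GabaiJDG1987, Cor. 8.3] -/
theorem two_le_of_witness
    (hR : ∀ (L : FramedLink (Fin 1)) (Y : Type) [TopologicalSpace Y] [T2Space Y]
      [SecondCountableTopology Y] [ChartedSpace (EuclideanSpace ℝ (Fin 3)) Y]
      [IsManifold (𝓡 3) ∞ Y] [CompactSpace Y] [ConnectedSpace Y],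
      IsSphereTwoProdCircleSum 1 Y → L.IsSurgery (𝓡 3) Y →
        (L.component 0).IsUnknot ∧ L.framing 0 = 0)
    {n : ℕ} (L : FramedLink (Fin n)) (Y : Type) [TopologicalSpace Y] [T2Space Y]
    [SecondCountableTopology Y] [ChartedSpace (EuclideanSpace ℝ (Fin 3)) Y]
    [IsManifold (𝓡 3) ∞ Y] [CompactSpace Y] [ConnectedSpace Y]
    (hY : IsSphereTwoProdCircleSum n Y) (hL : L.IsSurgery (𝓡 3) Y)
    (hgap : ∀ U : FramedLink (Fin n), U.IsZeroFramedUnlink →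
      ¬ IsStrictHandleSlideEquivalent ⟨n, L⟩ ⟨n, U⟩) : 2 ≤ n := by
  rcases n with _ | _ | n
  · exact absurd hgap (no_gap_at_zero L)
  · obtain ⟨hK, hf⟩ := hR L Y hY hL
    exact absurd (equiv_single_unknot_of_isUnknot L hK hf)
      (hgap _ single_unknot_zero_isZeroFramedUnlink)
  · omega

/-! ## Natural strengthenings, refuted -/

/-- **"Every R-link with at least one component resists sliding" is false**: the `0`-framed
unknot is an R-link and its own `0`-framed unlink. The crux can only be existential, and every
candidate engine must be calibrated on such slide-trivial R-links. [folklore] -/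
theorem not_forall_rlink_gap :
    ¬ ∀ (n : ℕ) (L : FramedLink (Fin n)) (Y : Type) [TopologicalSpace Y] [T2Space Y]
        [SecondCountableTopology Y] [ChartedSpace (EuclideanSpace ℝ (Fin 3)) Y]
        [IsManifold (𝓡 3) ∞ Y] [CompactSpace Y] [ConnectedSpace Y],
        0 < n → IsSphereTwoProdCircleSum n Y → L.IsSurgery (𝓡 3) Y →
        ∀ U : FramedLink (Fin n), U.IsZeroFramedUnlink →
          ¬ IsStrictHandleSlideEquivalent ⟨n, L⟩ ⟨n, U⟩ := by
  intro h
  obtain ⟨Y, i1, i2, i3, i4, i5, i6, i7, hY, hL⟩ := exists_rlink_one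
  exact h 1 (FramedLink.single unknot 0) Y one_pos hY hL _ single_unknot_zero_isZeroFramedUnlink
    (Relation.EqvGen.refl _)

/-- **Admitting blow-ups kills the crux** (modulo four results that are theorems in print, all
explicit hypotheses): replace `IsStrictHandleSlideEquivalent` by `StrictKirbyEquivalent` (the
same moves plus blow-ups/downs of split `±1`-unknots). An R-link's surgery `Y ≅ #ⁿ (S² × S¹)`
is diffeomorphic to the surgery on the `0`-framed `n`-unlink (`hU`, uniqueness of `#ⁿ S²×S¹`;
the unlink exists by `hE` and its surgery by the tree theorem
`exists_isSurgery_zeroFramedUnlink_holds`), so by Kirby's theorem in the unoriented form (`hK` =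
tree named fact `nonempty_diffeomorph_iff_strictKirbyEquivalent_or_mirror`; Kirby 1978 Thm 1,
Gompf–Stipsicz Thm 5.3.6) the link is strictly Kirby equivalent to that unlink or to its mirror,
again a `0`-framed unlink (`hM`). Hence the EXCLUSION OF BLOW-UPS is the load-bearing feature of
the crux's conclusion: a certificate must be a strict-slide invariant that is not a Kirby-move
(3-manifold) invariant. [cite: Kirby1978, Thm 1] -/
theorem gap_false_with_kirbyMoves_of
    (hK : nonempty_diffeomorph_iff_strictKirbyEquivalent_or_mirror.{0, 0})
    (hU : ∀ (n : ℕ) (Y Y' : Type) [TopologicalSpace Y] [T2Space Y] [SecondCountableTopology Y]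
      [ChartedSpace (EuclideanSpace ℝ (Fin 3)) Y] [IsManifold (𝓡 3) ∞ Y] [CompactSpace Y]
      [ConnectedSpace Y] [TopologicalSpace Y'] [T2Space Y'] [SecondCountableTopology Y']
      [ChartedSpace (EuclideanSpace ℝ (Fin 3)) Y'] [IsManifold (𝓡 3) ∞ Y'] [CompactSpace Y']
      [ConnectedSpace Y'],
      IsSphereTwoProdCircleSum n Y → IsSphereTwoProdCircleSum n Y' →
        Nonempty (Y ≃ₘ⟮𝓡 3, 𝓡 3⟯ Y'))
    (hE : ∀ n : ℕ, ∃ U : FramedLink (Fin n), U.IsZeroFramedUnlink)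
    (hM : ∀ (n : ℕ) (U : FramedLink (Fin n)), U.IsZeroFramedUnlink → U.mirror.IsZeroFramedUnlink) :
    ¬ ∃ (_ : Knot.TubularNbhd.SmoothnessFacts) (n : ℕ) (L : FramedLink (Fin n)) (Y : Type)
        (_ : TopologicalSpace Y) (_ : T2Space Y) (_ : SecondCountableTopology Y)
        (_ : ChartedSpace (EuclideanSpace ℝ (Fin 3)) Y) (_ : IsManifold (𝓡 3) ∞ Y)
        (_ : CompactSpace Y) (_ : ConnectedSpace Y),
        IsSphereTwoProdCircleSum n Y ∧ L.IsSurgery (𝓡 3) Y ∧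
          ∀ U : FramedLink (Fin n), U.IsZeroFramedUnlink → ¬ StrictKirbyEquivalent ⟨n, L⟩ ⟨n, U⟩ := by
  rintro ⟨inst, n, L, Y, _, _, _, _, _, _, _, hY, hL, hgap⟩
  obtain ⟨U, hUu⟩ := hE n
  obtain ⟨Y', _, _, _, _, _, _, _, hY', hU'⟩ := exists_isSurgery_zeroFramedUnlink_holds U hUu
  obtain ⟨e⟩ := hU n Y Y' hY hY'
  rcases (hK ⟨n, L⟩ ⟨n, U⟩ Y Y' hL hU').1 ⟨e⟩ with h | h
  · exact hgap U hUu h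
  · exact hgap U.mirror (hM n U hUu) h

/-! ## The certificate shape -/

/-- **The crux supplies its own separating strict-slide invariant** (valued in `Prop`): "slides
to some `0`-framed unlink with the same number of components" is constant along every strict
handle-slide move (moves preserve the component count and the class), TRUE on every `0`-framed
unlink and FALSE on the crux's witness. With `invariant_of_equiv` (the converse glue) this says:
a skeleton "∃ invariant, move-functorial ∧ separating ⇒ crux" with the invariant's codomain and
values unconstrained is a restatement of the crux; content enters only once the invariant is
NAMED and computable (e.g. the picked line's `(u_q(sl₂), Q_n(H), J)` through its functoriality
stub). [folklore] -/
theorem exists_separating_invariant_of_vrlSlideGap (hg : VrlSlideGap) :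
    ∃ (M : Type) (σ : FramedLinkFin → M),
      (∀ L L' : FramedLinkFin, StrictHandleSlideMove L L' → σ L = σ L') ∧
      ∃ (_ : Knot.TubularNbhd.SmoothnessFacts) (n : ℕ) (L : FramedLink (Fin n)) (Y : Type)
        (_ : TopologicalSpace Y) (_ : T2Space Y) (_ : SecondCountableTopology Y)
        (_ : ChartedSpace (EuclideanSpace ℝ (Fin 3)) Y) (_ : IsManifold (𝓡 3) ∞ Y)
        (_ : CompactSpace Y) (_ : ConnectedSpace Y),
        IsSphereTwoProdCircleSum n Y ∧ L.IsSurgery (𝓡 3) Y ∧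
          ∀ U : FramedLink (Fin n), U.IsZeroFramedUnlink → σ ⟨n, L⟩ ≠ σ ⟨n, U⟩ := by
  obtain ⟨inst, n, L, Y, i1, i2, i3, i4, i5, i6, i7, hY, hL, hgap⟩ := hg
  -- the invariant: "slides to some `0`-framed unlink with the same number of components"
  let σ : FramedLinkFin → Prop := fun X ↦
    ∃ U : FramedLink (Fin X.1), U.IsZeroFramedUnlink ∧ IsStrictHandleSlideEquivalent X ⟨X.1, U⟩
  have hmove : ∀ X X' : FramedLinkFin, StrictHandleSlideMove X X' → X.1 = X'.1 := by
    intro X X' h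
    cases h <;> rfl
  have hσ : ∀ X X' : FramedLinkFin, StrictHandleSlideMove X X' → σ X = σ X' := by
    intro X X' h
    have h1 := hmove X X' h
    obtain ⟨k, A⟩ := X
    obtain ⟨k', A'⟩ := X'
    dsimp only at h1
    subst h1
    apply propext
    constructor
    · rintro ⟨U, hU, hAU⟩
      exact ⟨U, hU, (Relation.EqvGen.symm _ _ (Relation.EqvGen.rel _ _ h)).trans _ _ _ hAU⟩
    · rintro ⟨U, hU, hAU⟩
      exact ⟨U, hU, (Relation.EqvGen.rel _ _ h).trans _ _ _ hAU⟩
  refine ⟨Prop, σ, hσ, inst, n, L, Y, i1, i2, i3, i4, i5, i6, i7, hY, hL, fun U hU hLU ↦ ?_⟩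
  have hσU : σ ⟨n, U⟩ := ⟨U, hU, Relation.EqvGen.refl _⟩
  have hσL : ¬ σ ⟨n, L⟩ := fun ⟨U', hU', hLU'⟩ ↦ hgap U' hU' hLU'
  exact hσL (hLU ▸ hσU)

end Summit.SmoothPoincare4.SmoothPoincare4.Theorems.VrlSlideGap.Negative.LoadBearing

end
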